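import Summits.QuantumFields.BalabanUV.Beta.GAN24.SliceFlatHeatTorusSecond
import Summits.QuantumFields.BalabanUV.T4Continuum.Support.SliceFlatFreeResolvent

/-!
# G-an2-4 ∕ (CONV-C), the SECOND-ORDER sup entries of the requester's refined (B5-1115-TABLE) line — flat supplier, part 3:
# the SECOND unit row differences of the FREE massive unit-lattice resolvent `F = (stencilE + n⁻²)⁻¹` on the NE3 carrier —
# block-localised bound `Σ_{q ∈ Δ(y₁)} |∇_μ∇_ν F(p, q)| ≤ C_d·(1 + log n)·e^{−α_d·nbd}`: THE LOGARITHM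

G-an2-4 formalisation swarm `b2b-balaban-gan24-formalise-*`, leaf prover 03 (gen 48), crux team (2) under the coordinator ruling
«YM REDIRECT» (e34b3e0c); third file of the chain `SliceFlatHeatSecond → SliceFlatHeatTorusSecond → SliceFlatFreeHessian →
SliceFlatHessian` (t4-ne3-p1's free-gradient chain ONE ORDER UP).  The requester (gan24-p2 gen 29, journal `CLAIMS.log` l.28555)
measured `‖G′∂′ᴴ∂′ᴴ‖_{∞→∞} ≈ 1.44, 1.88, 2.30, 2.55` at `n′ = 2, 4, 8, 12` — «the expected log»; road P2's audit (gen 28,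
`ROUTE-AUDIT-P2.md` §4) located it: «pure second differences — the discrete double Riesz transform, UNBOUNDED on ℓ^∞ by a log».
THIS FILE is where that logarithm is produced and bounded, for the free comparison operator of part 11
(`SliceFlatFreeResolvent.freeOp`, heat representation `freeOp_apply`: `F(p,q) = 𝟙[p₂ = q₂]·∫₀^∞ e^{−t/n²}·H_{2t}(p₁,q₁) dt`):
 * §1 **`integral_inv_max_exp_le`**: `∫₀^∞ (1 ∨ 2t)⁻¹·e^{−t/(2n²)} dt ≤ 1 + log (1 + 2n²)` for `n ≥ 1`, with integrability (majorant
   `𝟙_{t ≤ n²}·2/(2t+1) + (2n²)⁻¹e^{−t/(2n²)}`; `∫₀^{n²} 2dt/(2t+1) = log(1 + 2n²)`), and `1 + log(1 + 2n²) ≤ 3·(1 + log n)`;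
 * §2 the double row difference `rowDiff μ (rowDiff ν A)` (part 11's `rowDiff` iterated; `rowDiff_rowDiff_mul`) and the reduction of
   its block-fibre sums for `A = freeOp j` to Laplace integrals of part 2's double row difference of the product heat kernel
   (`cubeSum_rowDiff_rowDiff_freeOp_eq`);
 * §3 **`cubeSum_rowDiff_rowDiff_freeOp_le`**: for every level `j`, directions `μ, ν`, row `p` and block `y₁`,
   `Σ_{q : cubeI j q = y₁} |rowDiff μ (rowDiff ν (freeOp j)) p q| ≤ 106000·48^d · (1 + log n) · e^{−freeα d · nbd_j(cubeI j p, y₁)}`,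
   `n = L^{min(j,k)}`, constant `106000·48^d`, rate `freeα d = 1/(32(d+1))` (part 11's): part 2's `blockSum_rowDiff_rowDiff_prodHeat_le`
   at heat time `2t` with weight slope `freeα d/n` (cost `e^{16(d+1)(α/n)²(1∨2t)} ≤ e^{1/64}e^{t/(32n²)}`, absorbed by `e^{−t/n²}`),
   integrated against the Laplace weight: `∫₀^∞ (1∨2t)⁻¹ e^{−t/(2n²)} dt` is the log.
So the free second differences have block row sums `O(1 + log n)` — where the kernel has `O(n²)` and one difference `O(n)` —
with exponential decay in the block distance and constants depending on `d` only.  Nothing here is specific to a gauge theory.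

HONEST SCOPE.  Classical analysis of the free massive lattice resolvent; no statement of Bałaban's is asserted or used; the
sup → sup SECOND-ORDER bound with `(1 + log n)` is OUR statement ([B5] (1.112) prints a Hölder-source bound `‖J‖_ε`, no
logarithm) — not in print.  NOT (CONV-C), NEVER «G-an2-4 closed», NOT NE2 ∕ NE3, NOT D1, NOT BetaPertH, NOT continuum, NOT
Clay; not in print — our bookkeeping.  ABSOLUTE RULE of the cell kept: inputs are Mathlib and kernel-proved tree modules BY NAME
(parts 9 and 11 of the NE3 chain, parts 1–2 of this chain); every declaration is a definition-free [folklore] theorem; no `def`,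
no `def … : Prop`, no `sorry`, no axioms beyond Mathlib's.  PLACEMENT (human rule 2026-08-19): our results
under `Summits/QuantumFields/BalabanUV/`.  HONEST DEPENDENCY: continuum YM on T⁴ ⇐ BetaPertH ∧ nine spine estimates (0/9
proved); BetaPertH ⇐ (D1) ∧ (D4) ∧ CAP+tail; G-an2-4 gates asym, D1 and NE2/3/4.
-/

noncomputable section

open Real Finset Filter MeasureTheory Set

namespace Summit.QuantumFields.BalabanUV.Beta.GAN24.SliceFlatFreeHessian

open Literature.Probability.LatticeModels
open Literature.MathematicalPhysics.QuantumFieldTheory.Balaban1983to89.TreeLengthTorus (TPt)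
open Summit.QuantumFields.BalabanUV.T4Continuum
open SliceTorusBlocks SliceTorusTower SliceCovariantTower SliceFlatPropagator SliceFlatStencil
open SliceFlatHeatOneDim SliceFlatHeatTorus SliceFlatFreeKernel SliceFlatFreeResolvent
open Summit.QuantumFields.BalabanUV.Beta.GAN24.SliceFlatHeatTorusSecond

/-! ## §1  The logarithmic Laplace integral -/
section LogIntegral

/-- `(1 ∨ 2t)⁻¹ ≤ 2/(2t+1)` for `t ≥ 0` (`1 ∨ 2t ≥ t + 1/2`). [folklore] -/
theorem inv_max_le {t : ℝ} (ht : 0 ≤ t) : (max 1 (2 * t))⁻¹ ≤ 2 * (2 * t + 1)⁻¹ := by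
  have h1 : (2 * t + 1) / 2 ≤ max 1 (2 * t) := by
    rcases le_total 1 (2 * t) with h | h
    · rw [max_eq_right h]; linarith
    · rw [max_eq_left h]; linarith
  have h2 : (0 : ℝ) < (2 * t + 1) / 2 := by positivity
  calc (max 1 (2 * t))⁻¹ ≤ ((2 * t + 1) / 2)⁻¹ := inv_anti₀ h2 h1
    _ = 2 * (2 * t + 1)⁻¹ := by rw [inv_div, div_eq_mul_inv]

/-- `∫₀^{n²} 2/(2t+1) dt = log (1 + 2n²)`. [folklore] -/
theorem integral_two_div_le (n : ℝ) :
    ∫ t in (0 : ℝ)..n ^ 2, 2 * (2 * t + 1)⁻¹ = Real.log (1 + 2 * n ^ 2) := by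
  have h := intervalIntegral.integral_comp_mul_add (a := 0) (b := n ^ 2) (fun u : ℝ => u⁻¹) two_ne_zero 1
  simp only [mul_zero, zero_add, smul_eq_mul] at h
  rw [intervalIntegral.integral_const_mul, h, integral_inv_of_pos one_pos (by positivity), div_one, ← mul_assoc,
    mul_inv_cancel₀ two_ne_zero, one_mul, add_comm]

/-- **The logarithmic Laplace integral**: `∫₀^∞ (1 ∨ 2t)⁻¹·e^{−t/(2n²)} dt ≤ 1 + log (1 + 2n²)` for `n ≥ 1`, with integrability.
Majorant `𝟙_{(0,n²]}(t)·2/(2t+1) + (2n²)⁻¹·e^{−t/(2n²)}` (on `t > n²`, `(1 ∨ 2t)⁻¹ ≤ (2n²)⁻¹`). [folklore] -/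
theorem integral_inv_max_exp_le {n : ℝ} (hn : 1 ≤ n) :
    IntegrableOn (fun t : ℝ => (max 1 (2 * t))⁻¹ * Real.exp (-((2 * n ^ 2)⁻¹ * t))) (Ioi 0) ∧
      ∫ t in Ioi (0 : ℝ), (max 1 (2 * t))⁻¹ * Real.exp (-((2 * n ^ 2)⁻¹ * t)) ≤ 1 + Real.log (1 + 2 * n ^ 2) := by
  have hn0 : 0 < n := by linarith
  set c : ℝ := (2 * n ^ 2)⁻¹ with hc
  have hc0 : 0 < c := by positivity
  -- the exponential
  have hE : IntegrableOn (fun t : ℝ => Real.exp (-(c * t))) (Ioi 0) := by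
    have e : (fun t : ℝ => Real.exp (-(c * t))) = fun t => Real.exp (-c * t) := by funext t; ring_nf
    rw [e]; exact exp_neg_integrableOn_Ioi 0 hc0
  have hEint : ∫ t in Ioi (0 : ℝ), c * Real.exp (-(c * t)) = 1 := by
    have e : (fun t : ℝ => c * Real.exp (-(c * t))) = fun t => c * Real.exp (-c * t) := by funext t; ring_nf
    rw [e, integral_const_mul, integral_exp_mul_Ioi (by linarith : -c < 0)]
    field_simp
    simp
  -- the integrand `f`
  have hmax0 : ∀ t : ℝ, 0 < max 1 (2 * t) := fun t => lt_of_lt_of_le one_pos (le_max_left _ _)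
  have hcont : Continuous fun t : ℝ => (max 1 (2 * t))⁻¹ * Real.exp (-(c * t)) :=
    ((continuous_const.max (by fun_prop)).inv₀ fun t => (hmax0 t).ne').mul (by fun_prop)
  have hf : IntegrableOn (fun t : ℝ => (max 1 (2 * t))⁻¹ * Real.exp (-(c * t))) (Ioi 0) := by
    refine Integrable.mono' hE hcont.aestronglyMeasurable ?_
    refine (ae_restrict_iff' measurableSet_Ioi).2 (Filter.Eventually.of_forall fun t (_ : 0 < t) => ?_)
    rw [Real.norm_eq_abs, abs_of_nonneg (by positivity)]
    have h1 : (max 1 (2 * t))⁻¹ ≤ 1 := inv_le_one_of_one_le₀ (le_max_left _ _)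
    calc (max 1 (2 * t))⁻¹ * Real.exp (-(c * t)) ≤ 1 * Real.exp (-(c * t)) :=
        mul_le_mul_of_nonneg_right h1 (Real.exp_pos _).le
      _ = _ := one_mul _
  refine ⟨hf, ?_⟩
  -- the majorant `G = 𝟙_{(0,n²]}·h + c·e^{−ct}`
  set h : ℝ → ℝ := fun t => 2 * (2 * t + 1)⁻¹ with hh
  have hhc : ContinuousOn h (Icc 0 (n ^ 2)) := by
    refine ContinuousOn.mul continuousOn_const (ContinuousOn.inv₀ (Continuous.continuousOn (by fun_prop)) fun t ht => ?_)
    have : 0 ≤ t := ht.1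
    positivity
  have hhI : IntegrableOn h (Icc 0 (n ^ 2)) := hhc.integrableOn_Icc
  have hG1 : IntegrableOn (fun t => Set.indicator (Ioc 0 (n ^ 2)) h t) (Ioi 0) := by
    rw [IntegrableOn, integrable_indicator_iff measurableSet_Ioc, IntegrableOn, Measure.restrict_restrict measurableSet_Ioc]
    exact hhI.mono_set (Set.inter_subset_left.trans Set.Ioc_subset_Icc_self)
  have hG2 : IntegrableOn (fun t : ℝ => c * Real.exp (-(c * t))) (Ioi 0) := hE.const_mul c
  have hG : IntegrableOn (fun t => Set.indicator (Ioc 0 (n ^ 2)) h t + c * Real.exp (-(c * t))) (Ioi 0) := hG1.add hG2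
  -- pointwise domination on `t > 0`
  have hpt : ∀ t ∈ Ioi (0 : ℝ), (max 1 (2 * t))⁻¹ * Real.exp (-(c * t))
      ≤ Set.indicator (Ioc 0 (n ^ 2)) h t + c * Real.exp (-(c * t)) := by
    intro t ht
    have ht0 : (0 : ℝ) < t := ht
    have he1 : Real.exp (-(c * t)) ≤ 1 := by rw [Real.exp_le_one_iff]; exact neg_nonpos.2 (by positivity)
    have he0 : 0 ≤ Real.exp (-(c * t)) := (Real.exp_pos _).le
    by_cases htn : t ≤ n ^ 2
    · have hmem : t ∈ Ioc 0 (n ^ 2) := ⟨ht0, htn⟩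
      rw [Set.indicator_of_mem hmem]
      have h1 := inv_max_le ht0.le
      calc (max 1 (2 * t))⁻¹ * Real.exp (-(c * t)) ≤ (2 * (2 * t + 1)⁻¹) * 1 :=
            mul_le_mul h1 he1 he0 (by positivity)
        _ = h t := by simp [hh]
        _ ≤ h t + c * Real.exp (-(c * t)) := le_add_of_nonneg_right (by positivity)
    · have htn' : n ^ 2 < t := lt_of_not_ge htn
      have hmem : t ∉ Ioc 0 (n ^ 2) := fun hm => htn hm.2
      rw [Set.indicator_of_notMem hmem, zero_add]
      have h2t : 2 * n ^ 2 ≤ max 1 (2 * t) := le_trans (by linarith) (le_max_right _ _)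
      have h1 : (max 1 (2 * t))⁻¹ ≤ c := by rw [hc]; exact inv_anti₀ (by positivity) h2t
      exact mul_le_mul_of_nonneg_right h1 he0
  -- the integral of the majorant
  have hI1 : ∫ t in Ioi (0 : ℝ), Set.indicator (Ioc 0 (n ^ 2)) h t = Real.log (1 + 2 * n ^ 2) := by
    rw [setIntegral_indicator measurableSet_Ioc, Set.inter_eq_right.2 Set.Ioc_subset_Ioi_self,
      ← intervalIntegral.integral_of_le (by positivity : (0 : ℝ) ≤ n ^ 2)]
    exact integral_two_div_le n
  calc ∫ t in Ioi (0 : ℝ), (max 1 (2 * t))⁻¹ * Real.exp (-(c * t))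
      ≤ ∫ t in Ioi (0 : ℝ), (Set.indicator (Ioc 0 (n ^ 2)) h t + c * Real.exp (-(c * t))) :=
        setIntegral_mono_on hf hG measurableSet_Ioi hpt
    _ = (∫ t in Ioi (0 : ℝ), Set.indicator (Ioc 0 (n ^ 2)) h t) + ∫ t in Ioi (0 : ℝ), c * Real.exp (-(c * t)) :=
        integral_add hG1 hG2
    _ = 1 + Real.log (1 + 2 * n ^ 2) := by rw [hI1, hEint, add_comm]

/-- `log 3 ≤ 2` (crudely: `3 ≤ e²` since `e ≥ 2`). [folklore] -/
theorem log_three_le_two : Real.log 3 ≤ 2 := by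
  rw [Real.log_le_iff_le_exp (by norm_num)]
  have h := Real.add_one_le_exp (1 : ℝ)
  have h2 : Real.exp 2 = Real.exp 1 * Real.exp 1 := by rw [← Real.exp_add]; norm_num
  nlinarith [Real.exp_pos (1 : ℝ)]

/-- `1 + log(1 + 2n²) ≤ 3·(1 + log n)` for `n ≥ 1`. [folklore] -/
theorem one_add_log_le {n : ℝ} (hn : 1 ≤ n) : 1 + Real.log (1 + 2 * n ^ 2) ≤ 3 * (1 + Real.log n) := by
  have hn0 : 0 < n := by linarith
  have h1 : 1 + 2 * n ^ 2 ≤ 3 * n ^ 2 := by nlinarith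
  have h2 : Real.log (1 + 2 * n ^ 2) ≤ Real.log (3 * n ^ 2) := Real.log_le_log (by positivity) h1
  have h3 : Real.log (3 * n ^ 2) = Real.log 3 + 2 * Real.log n := by
    rw [Real.log_mul (by norm_num) (by positivity), Real.log_pow]; push_cast; ring
  have h4 : 0 ≤ Real.log n := Real.log_nonneg hn
  linarith [log_three_le_two]

end LogIntegral

/-! ## §2  The double row difference and its reduction to heat integrals -/
section Reduction

variable (d k N L : ℕ) [NeZero N] [NeZero L]

omit [NeZero N] [NeZero L] in
/-- The double row difference, entrywise: `rowDiff μ (rowDiff ν A)(p,q) = A(p₁+e_μ+e_ν) − A(p₁+e_μ) − A(p₁+e_ν) + A(p₁)` (all at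
component `p₂`, column `q`). [folklore] -/
theorem rowDiff_rowDiff_apply (μ ν : Fin (d + 1)) (A : Matrix (TPt (d + 1) (N * L ^ k) × Fin (d + 1))
    (TPt (d + 1) (N * L ^ k) × Fin (d + 1)) ℝ) (p q : TPt (d + 1) (N * L ^ k) × Fin (d + 1)) :
    rowDiff d k N L μ (rowDiff d k N L ν A) p q
      = A (p.1 + Pi.single μ 1 + Pi.single ν 1, p.2) q - A (p.1 + Pi.single μ 1, p.2) q
        - A (p.1 + Pi.single ν 1, p.2) q + A p q := by
  simp only [rowDiff]
  ring

/-- Double row differences commute with right multiplication. [folklore] -/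
theorem rowDiff_rowDiff_mul (μ ν : Fin (d + 1)) (A B : Matrix (TPt (d + 1) (N * L ^ k) × Fin (d + 1))
    (TPt (d + 1) (N * L ^ k) × Fin (d + 1)) ℝ) :
    rowDiff d k N L μ (rowDiff d k N L ν (A * B)) = rowDiff d k N L μ (rowDiff d k N L ν A) * B := by
  rw [rowDiff_mul, rowDiff_mul]

/-- The block-fibre sum of the double row difference of the free operator reduces to the site fibre (only the component `q₂ = p₂`
contributes) and to Laplace integrals of the double row difference of the product heat kernel. [folklore] -/
theorem cubeSum_rowDiff_rowDiff_freeOp_eq (j : ℕ) (μ ν : Fin (d + 1)) (p : TPt (d + 1) (N * L ^ k) × Fin (d + 1))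
    (y₁ : TPt (d + 1) (levM k N L j)) :
    ∑ q ∈ Finset.univ.filter (fun q => cubeI (d + 1) k N L (Fin (d + 1)) j q = y₁),
        |rowDiff d k N L μ (rowDiff d k N L ν (freeOp d k N L j)) p q|
      = ∑ z ∈ Finset.univ.filter (fun z : TPt (d + 1) (N * L ^ k) => cube (d + 1) k N L j z = y₁),
          |∫ t in Ioi (0 : ℝ), Real.exp (-((((side k L j : ℝ) ^ 2)⁻¹) * t)) *
            (prodHeat (2 * t) (p.1 + Pi.single μ 1 + Pi.single ν 1) z - prodHeat (2 * t) (p.1 + Pi.single μ 1) z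
              - prodHeat (2 * t) (p.1 + Pi.single ν 1) z + prodHeat (2 * t) p.1 z)| := by
  classical
  have hI := integrable_exp_mul_prodHeat d k N L j
  set m : ℝ := ((side k L j : ℝ) ^ 2)⁻¹ with hm
  have hsub : ∀ z : TPt (d + 1) (N * L ^ k),
      (∫ t in Ioi (0 : ℝ), Real.exp (-(m * t)) * prodHeat (2 * t) (p.1 + Pi.single μ 1 + Pi.single ν 1) z)
        - (∫ t in Ioi (0 : ℝ), Real.exp (-(m * t)) * prodHeat (2 * t) (p.1 + Pi.single μ 1) z)
        - (∫ t in Ioi (0 : ℝ), Real.exp (-(m * t)) * prodHeat (2 * t) (p.1 + Pi.single ν 1) z)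
        + (∫ t in Ioi (0 : ℝ), Real.exp (-(m * t)) * prodHeat (2 * t) p.1 z)
        = ∫ t in Ioi (0 : ℝ), Real.exp (-(m * t)) *
            (prodHeat (2 * t) (p.1 + Pi.single μ 1 + Pi.single ν 1) z - prodHeat (2 * t) (p.1 + Pi.single μ 1) z
              - prodHeat (2 * t) (p.1 + Pi.single ν 1) z + prodHeat (2 * t) p.1 z) := by
    intro z
    have hA := hI (p.1 + Pi.single μ 1 + Pi.single ν 1) z
    have hB := hI (p.1 + Pi.single μ 1) z
    have hC := hI (p.1 + Pi.single ν 1) z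
    have hD := hI p.1 z
    have hAB : IntegrableOn (fun t : ℝ => Real.exp (-(m * t)) * prodHeat (2 * t) (p.1 + Pi.single μ 1 + Pi.single ν 1) z
        - Real.exp (-(m * t)) * prodHeat (2 * t) (p.1 + Pi.single μ 1) z) (Ioi 0) := hA.sub hB
    have hABC : IntegrableOn (fun t : ℝ => Real.exp (-(m * t)) * prodHeat (2 * t) (p.1 + Pi.single μ 1 + Pi.single ν 1) z
        - Real.exp (-(m * t)) * prodHeat (2 * t) (p.1 + Pi.single μ 1) z
        - Real.exp (-(m * t)) * prodHeat (2 * t) (p.1 + Pi.single ν 1) z) (Ioi 0) := hAB.sub hC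
    rw [← integral_sub hA hB, ← integral_sub hAB hC, ← integral_add hABC hD]
    refine setIntegral_congr_fun measurableSet_Ioi fun t _ => ?_
    ring
  have hterm : ∀ q : TPt (d + 1) (N * L ^ k) × Fin (d + 1), |rowDiff d k N L μ (rowDiff d k N L ν (freeOp d k N L j)) p q|
      = if p.2 = q.2 then |∫ t in Ioi (0 : ℝ), Real.exp (-(m * t)) *
          (prodHeat (2 * t) (p.1 + Pi.single μ 1 + Pi.single ν 1) q.1 - prodHeat (2 * t) (p.1 + Pi.single μ 1) q.1
            - prodHeat (2 * t) (p.1 + Pi.single ν 1) q.1 + prodHeat (2 * t) p.1 q.1)| else 0 := by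
    intro q
    rw [rowDiff_rowDiff_apply]
    simp only [freeOp_apply]
    split_ifs with h
    · rw [← hm, hsub]
    · simp
  rw [Finset.sum_filter, Finset.sum_filter, Fintype.sum_prod_type]
  refine Finset.sum_congr rfl fun z _ => ?_
  simp only [cubeI_apply, hterm]
  split_ifs with hz
  · rw [Finset.sum_ite_eq]; simp
  · simp

end Reduction

/-! ## §3  The block-localised bound: `O(1 + log n)` -/
section Hessian

variable (d k N L : ℕ) [NeZero N] [NeZero L]

/-- `16(d+1)·(freeα d)² ≤ 1/64`. [folklore] -/
theorem sixteen_mul_freeα_sq_le (d : ℕ) : 16 * ((d : ℝ) + 1) * (freeα d) ^ 2 ≤ 1 / 64 := by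
  unfold freeα
  rw [div_pow, one_pow, show (32 * ((d : ℝ) + 1)) ^ 2 = 1024 * ((d : ℝ) + 1) * ((d : ℝ) + 1) by ring]
  rw [mul_one_div, div_le_iff₀ (by positivity)]
  nlinarith [(Nat.cast_nonneg d : (0 : ℝ) ≤ d)]

/-- Numerics: `33075·e^{1/32}·e^{1/64}·3 ≤ 106000`. [folklore] -/
theorem const_le : 33075 * Real.exp (1 / 32) * Real.exp (1 / 64) * 3 ≤ 106000 := by
  rw [mul_assoc (33075 : ℝ), ← Real.exp_add]
  have h : Real.exp (1 / 32 + 1 / 64 : ℝ) ≤ 1 + 3 / 64 + (3 / 64) ^ 2 := by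
    have hb := Real.exp_bound' (x := 1 / 32 + 1 / 64) (by norm_num) (by norm_num) (n := 2) (by norm_num)
    simp only [Finset.sum_range_succ, Finset.sum_range_zero, Nat.factorial] at hb
    norm_num at hb ⊢
    linarith
  nlinarith [Real.exp_pos (1 / 32 + 1 / 64 : ℝ)]

/-- **THE BLOCK-LOCALISED BOUND FOR THE SECOND UNIT ROW DIFFERENCES OF THE FREE RESOLVENT** (the free comparison operator's
`∇∇F`, level-free and volume-free constants): for every level `j`, directions `μ, ν`, row `p` and block `y₁`,
`Σ_{q : cubeI j q = y₁} |rowDiff μ (rowDiff ν (freeOp j)) p q| ≤ 106000·48^d · (1 + log n) · e^{−freeα d · nbd_j(cubeI j p, y₁)}`,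
`n = L^{min(j,k)}`.  Proof: part 2's `blockSum_rowDiff_rowDiff_prodHeat_le` at heat time `2t` with weight slope `freeα d/n`,
integrated against `e^{−t/n²}`; the weight's cost `e^{t/(32n²)}` is absorbed and `∫₀^∞ (1∨2t)⁻¹e^{−t/(2n²)} dt ≤ 1 + log(1+2n²) ≤
3(1 + log n)`. [folklore] -/
theorem cubeSum_rowDiff_rowDiff_freeOp_le (j : ℕ) (μ ν : Fin (d + 1)) (p : TPt (d + 1) (N * L ^ k) × Fin (d + 1))
    (y₁ : TPt (d + 1) (levM k N L j)) :
    ∑ q ∈ Finset.univ.filter (fun q => cubeI (d + 1) k N L (Fin (d + 1)) j q = y₁),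
        |rowDiff d k N L μ (rowDiff d k N L ν (freeOp d k N L j)) p q|
      ≤ 106000 * 48 ^ d * (1 + Real.log (side k L j : ℝ)) *
        Real.exp (-(freeα d * nbd (d + 1) k N L j (cubeI (d + 1) k N L (Fin (d + 1)) j p) y₁)) := by
  classical
  obtain ⟨hα0, hα32⟩ := freeα_pos_le d
  have hn1 : (1 : ℝ) ≤ (side k L j : ℝ) := by exact_mod_cast one_le_side k L j
  have hn0 : (0 : ℝ) < (side k L j : ℝ) := by linarith
  set n : ℝ := (side k L j : ℝ) with hndef
  set m : ℝ := (n ^ 2)⁻¹ with hmdef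
  have hm : 0 < m := by positivity
  set filt := Finset.univ.filter (fun z : TPt (d + 1) (N * L ^ k) => cube (d + 1) k N L j z = y₁) with hfilt
  set Dn : ℝ := (nbd (d + 1) k N L j (cubeI (d + 1) k N L (Fin (d + 1)) j p) y₁ : ℝ) with hDn
  -- the integrands and the majorant
  set f : TPt (d + 1) (N * L ^ k) → ℝ → ℝ := fun z t =>
    Real.exp (-(m * t)) * (prodHeat (2 * t) (p.1 + Pi.single μ 1 + Pi.single ν 1) z - prodHeat (2 * t) (p.1 + Pi.single μ 1) z
      - prodHeat (2 * t) (p.1 + Pi.single ν 1) z + prodHeat (2 * t) p.1 z) with hf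
  set K : ℝ := 33075 * 48 ^ d * Real.exp (freeα d * (d + 1)) * Real.exp (1 / 64) * Real.exp (-(freeα d * Dn)) with hK
  have hK0 : 0 ≤ K := by rw [hK]; positivity
  set M : ℝ → ℝ := fun t => K * ((max 1 (2 * t))⁻¹ * Real.exp (-((2 * n ^ 2)⁻¹ * t))) with hM
  have hI := integrable_exp_mul_prodHeat d k N L j
  have hfi : ∀ z, IntegrableOn (f z) (Ioi 0) := fun z => by
    have h := (((hI (p.1 + Pi.single μ 1 + Pi.single ν 1) z).sub (hI (p.1 + Pi.single μ 1) z)).sub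
      (hI (p.1 + Pi.single ν 1) z)).add (hI p.1 z)
    refine h.congr_fun (fun t _ => ?_) measurableSet_Ioi
    simp only [hf, Pi.sub_apply, Pi.add_apply]; ring
  obtain ⟨hMi0, hMle⟩ := integral_inv_max_exp_le hn1
  have hMi : IntegrableOn M (Ioi 0) := hMi0.const_mul K
  -- pointwise: `Σ_z |f z t| ≤ M t` on `t > 0`
  have hpt : ∀ t ∈ Ioi (0 : ℝ), ∑ z ∈ filt, |f z t| ≤ M t := by
    intro t ht
    have ht0 : (0 : ℝ) < t := ht
    have h2t : (0 : ℝ) < 2 * t := by linarith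
    have hblk := blockSum_rowDiff_rowDiff_prodHeat_le (d := d) (fine_eq_levM_mul_side k N L j) h2t hα0.le hα32 p.1 y₁ μ ν
    have habs : ∑ z ∈ filt, |f z t| = Real.exp (-(m * t)) *
        ∑ z ∈ filt, |prodHeat (2 * t) (p.1 + Pi.single μ 1 + Pi.single ν 1) z - prodHeat (2 * t) (p.1 + Pi.single μ 1) z
          - prodHeat (2 * t) (p.1 + Pi.single ν 1) z + prodHeat (2 * t) p.1 z| := by
      rw [Finset.mul_sum]
      refine Finset.sum_congr rfl fun z _ => ?_
      simp only [hf, abs_mul, abs_of_pos (Real.exp_pos _)]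
    rw [habs]
    have hnbd : (npl1 (blockPt (levM k N L j) (side k L j) p.1 - y₁) : ℝ) = Dn := rfl
    obtain ⟨hT1, hT0, -, -, -⟩ := max_one_facts (2 * t)
    have hTle : max 1 (2 * t) ≤ 1 + 2 * t := max_le (by linarith) (by linarith)
    have hexp : Real.exp (-(m * t)) * Real.exp (16 * (d + 1) * (freeα d / (side k L j : ℝ)) ^ 2 * max 1 (2 * t))
        ≤ Real.exp (1 / 64) * Real.exp (-((2 * n ^ 2)⁻¹ * t)) := by
      rw [← Real.exp_add, ← Real.exp_add]
      refine Real.exp_le_exp.2 ?_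
      have hα2 := sixteen_mul_freeα_sq_le d
      have hn2 : (1 : ℝ) ≤ n ^ 2 := by nlinarith
      have e1 : 16 * ((d : ℝ) + 1) * (freeα d / n) ^ 2 * max 1 (2 * t)
          = (16 * ((d : ℝ) + 1) * (freeα d) ^ 2) * (max 1 (2 * t) / n ^ 2) := by rw [div_pow]; ring
      rw [hmdef, ← hndef, e1]
      have h3 : (16 * ((d : ℝ) + 1) * (freeα d) ^ 2) * (max 1 (2 * t) / n ^ 2) ≤ 1 / 64 * ((1 + 2 * t) / n ^ 2) :=
        mul_le_mul hα2 (div_le_div_of_nonneg_right hTle (by positivity)) (by positivity) (by norm_num)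
      have h4 : 1 / 64 * ((1 + 2 * t) / n ^ 2) ≤ 1 / 64 + t / (32 * n ^ 2) := by
        rw [show 1 / 64 * ((1 + 2 * t) / n ^ 2) = (1 / 64) / n ^ 2 + t / (32 * n ^ 2) by field_simp; ring]
        have : (1 / 64 : ℝ) / n ^ 2 ≤ 1 / 64 := div_le_self (by norm_num) hn2
        linarith
      have h5 : -((n ^ 2)⁻¹ * t) + (1 / 64 + t / (32 * n ^ 2)) ≤ 1 / 64 + -((2 * n ^ 2)⁻¹ * t) := by
        rw [show -((n ^ 2)⁻¹ * t) + (1 / 64 + t / (32 * n ^ 2)) = 1 / 64 - (31 / 32) * (t / n ^ 2) by field_simp; ring,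
          show 1 / 64 + -((2 * n ^ 2)⁻¹ * t) = 1 / 64 - (1 / 2) * (t / n ^ 2) by field_simp; ring]
        have : 0 ≤ t / n ^ 2 := by positivity
        nlinarith
      linarith
    calc Real.exp (-(m * t)) * ∑ z ∈ filt, |prodHeat (2 * t) (p.1 + Pi.single μ 1 + Pi.single ν 1) z
          - prodHeat (2 * t) (p.1 + Pi.single μ 1) z - prodHeat (2 * t) (p.1 + Pi.single ν 1) z + prodHeat (2 * t) p.1 z|
        ≤ Real.exp (-(m * t)) * (33075 * 48 ^ d * Real.exp (freeα d * (d + 1)) * (max 1 (2 * t))⁻¹ *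
            Real.exp (16 * (d + 1) * (freeα d / (side k L j : ℝ)) ^ 2 * max 1 (2 * t)) * Real.exp (-(freeα d * Dn))) := by
          rw [← hnbd]; exact mul_le_mul_of_nonneg_left hblk (Real.exp_pos _).le
      _ = 33075 * 48 ^ d * Real.exp (freeα d * (d + 1)) * Real.exp (-(freeα d * Dn)) *
            (max 1 (2 * t))⁻¹ *
            (Real.exp (-(m * t)) * Real.exp (16 * (d + 1) * (freeα d / (side k L j : ℝ)) ^ 2 * max 1 (2 * t))) := by ring
      _ ≤ 33075 * 48 ^ d * Real.exp (freeα d * (d + 1)) * Real.exp (-(freeα d * Dn)) *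
            (max 1 (2 * t))⁻¹ * (Real.exp (1 / 64) * Real.exp (-((2 * n ^ 2)⁻¹ * t))) := by
          gcongr
      _ = M t := by simp only [hM, hK]; ring
  -- integrability of `Σ_z |f z|`
  have hsi : IntegrableOn (fun t => ∑ z ∈ filt, |f z t|) (Ioi 0) :=
    integrable_finsetSum _ fun z _ => (hfi z).abs
  have hlog0 : 0 ≤ 1 + Real.log n := by have := Real.log_nonneg hn1; linarith
  -- assemble
  calc ∑ q ∈ Finset.univ.filter (fun q => cubeI (d + 1) k N L (Fin (d + 1)) j q = y₁),
        |rowDiff d k N L μ (rowDiff d k N L ν (freeOp d k N L j)) p q|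
      = ∑ z ∈ filt, |∫ t in Ioi (0 : ℝ), f z t| := by
        rw [cubeSum_rowDiff_rowDiff_freeOp_eq]
    _ ≤ ∑ z ∈ filt, ∫ t in Ioi (0 : ℝ), |f z t| := Finset.sum_le_sum fun z _ => abs_integral_le_integral_abs
    _ = ∫ t in Ioi (0 : ℝ), ∑ z ∈ filt, |f z t| := (integral_finsetSum _ fun z _ => (hfi z).abs).symm
    _ ≤ ∫ t in Ioi (0 : ℝ), M t := setIntegral_mono_on hsi hMi measurableSet_Ioi hpt
    _ = K * ∫ t in Ioi (0 : ℝ), (max 1 (2 * t))⁻¹ * Real.exp (-((2 * n ^ 2)⁻¹ * t)) := by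
        simp only [hM]; exact integral_const_mul K _
    _ ≤ K * (1 + Real.log (1 + 2 * n ^ 2)) := mul_le_mul_of_nonneg_left hMle hK0
    _ ≤ K * (3 * (1 + Real.log n)) := mul_le_mul_of_nonneg_left (one_add_log_le hn1) hK0
    _ ≤ 106000 * 48 ^ d * (1 + Real.log n) * Real.exp (-(freeα d * Dn)) := by
        rw [hK]
        have h1 : Real.exp (freeα d * (d + 1)) = Real.exp (1 / 32) := by
          congr 1; unfold freeα; field_simp
        rw [h1]
        have hE : 0 ≤ Real.exp (-(freeα d * Dn)) := (Real.exp_pos _).le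
        have h48 : (0 : ℝ) ≤ 48 ^ d := by positivity
        have hc := const_le
        nlinarith [mul_nonneg (mul_nonneg h48 hE) hlog0]

end Hessian

end Summit.QuantumFields.BalabanUV.Beta.GAN24.SliceFlatFreeHessian
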